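import Summits.AnomalousDissipation.AnomalousDissipation.Theses.RuelleSaturation

/-!
# Birth skeleton for piece K = `KolmogorovHorizonCapture` (split child 2/3 of KolmogorovHorizonChaos)

Two named stubs and the kernel-checked `KolmogorovHorizonCapture_of`:
* `stub_lagrangianFlowExists` — the route's own construction statement `RuelleSaturation.LagrangianFlowExists`
  (item stmt-AnomalousDissipation-1289, support, provable now: Picard–Lindelöf + variational equation + Liouville);
* `stub_captureGivenFlow` — the CAPTURE ESTIMATE for given Lagrangian data (K with `∀ D J, interface → inequality`):
  the open physics (linear-regime lemma Λ_τ ≥ λ_max(S̄) − Cτ sup|∇u|² first; intermittent set is the bet).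
-/

open MeasureTheory Filter Topology Set

noncomputable section

namespace Summit.AnomalousDissipation.AnomalousDissipation.Cruxes.KolmogorovHorizonChaos.SplitWindowCapture.CaptureBirth

/-- Piece K, verbatim (split child 2/3). -/
def KolmogorovHorizonCapture : Prop :=
  ∀ f : UnitAddTorus (Fin 3) → EuclideanSpace ℝ (Fin 3), Literature.Analysis.FunctionSpaces.Torus.IsSmooth f → Literature.Analysis.FunctionSpaces.Torus.IsDivFree f → Literature.Analysis.FunctionSpaces.Torus.HasZeroMean f →
  ∀ E₀ : ℝ, ∃ M κ β : ℝ, 0 < M ∧ 0 < κ ∧ ∀ ν : ℝ, 0 < ν → ν ≤ 1 → ∀ L : ℝ, 0 ≤ L →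
    ∀ (u : ℝ → UnitAddTorus (Fin 3) → EuclideanSpace ℝ (Fin 3)) (p : ℝ → UnitAddTorus (Fin 3) → ℝ),
      Literature.Analysis.FunctionSpaces.Torus.IsSmoothSpaceTimeOn Set.univ u → (∀ t, Literature.Analysis.FunctionSpaces.Torus.IsDivFree (u t)) →
      Literature.Analysis.FunctionSpaces.Torus.IsClassicalNSSolutionOn (Set.Icc 0 (L + Real.sqrt (ν / M))) ν (fun _ => f) u p →
      (∀ t ∈ Set.Icc 0 (L + Real.sqrt (ν / M)), MeasureTheory.integral MeasureTheory.volume (fun x : UnitAddTorus (Fin 3) => ‖u t x‖ ^ 2) ≤ E₀) →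
      ∃ (D : ℝ → ℝ → UnitAddTorus (Fin 3) → EuclideanSpace ℝ (Fin 3)) (J : ℝ → ℝ → UnitAddTorus (Fin 3) → (EuclideanSpace ℝ (Fin 3) →L[ℝ] EuclideanSpace ℝ (Fin 3))),
        ((∀ t x, D t t x = 0) ∧
          (∀ t s x, HasDerivAt (fun r => D t r x) (u s (x + Literature.Analysis.FunctionSpaces.Torus.proj (D t s x))) s) ∧
          (∀ t x, J t t x = ContinuousLinearMap.id ℝ (EuclideanSpace ℝ (Fin 3))) ∧
          (∀ t s x, HasDerivAt (fun r => J t r x) ((Literature.Analysis.FunctionSpaces.Torus.fderiv (u s) (x + Literature.Analysis.FunctionSpaces.Torus.proj (D t s x))).comp (J t s x)) s) ∧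
          (∀ t s, MeasureTheory.MeasurePreserving (fun x : UnitAddTorus (Fin 3) => x + Literature.Analysis.FunctionSpaces.Torus.proj (D t s x)) MeasureTheory.volume MeasureTheory.volume) ∧
          Continuous (fun q : ℝ × ℝ × UnitAddTorus (Fin 3) => (D q.1 q.2.1 q.2.2, J q.1 q.2.1 q.2.2))) ∧
        κ * (ν * ∫ t in (0 : ℝ)..(L + Real.sqrt (ν / M)), Literature.Analysis.FunctionSpaces.Torus.gradNormSq (u t)) - β ≤
          ν * ∫ t in (0 : ℝ)..L, MeasureTheory.integral MeasureTheory.volume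
            (fun x : UnitAddTorus (Fin 3) => ((Real.sqrt (ν / M))⁻¹ * Real.log ‖J t (t + Real.sqrt (ν / M)) x‖) ^ 2)

/-- STUB 1 (known construction; = item 1289 by name): Lagrangian flow data exist for every globally smooth
slice-wise divergence-free field. -/
theorem stub_lagrangianFlowExists :
    Summit.AnomalousDissipation.AnomalousDissipation.Theses.RuelleSaturation.LagrangianFlowExists := by
  sorry

/-- STUB 2 (the estimate): Kolmogorov-horizon capture for GIVEN Lagrangian data satisfying the interface. -/
theorem stub_captureGivenFlow :
    ∀ f : UnitAddTorus (Fin 3) → EuclideanSpace ℝ (Fin 3), Literature.Analysis.FunctionSpaces.Torus.IsSmooth f → Literature.Analysis.FunctionSpaces.Torus.IsDivFree f → Literature.Analysis.FunctionSpaces.Torus.HasZeroMean f →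
    ∀ E₀ : ℝ, ∃ M κ β : ℝ, 0 < M ∧ 0 < κ ∧ ∀ ν : ℝ, 0 < ν → ν ≤ 1 → ∀ L : ℝ, 0 ≤ L →
    ∀ (u : ℝ → UnitAddTorus (Fin 3) → EuclideanSpace ℝ (Fin 3)) (p : ℝ → UnitAddTorus (Fin 3) → ℝ),
    Literature.Analysis.FunctionSpaces.Torus.IsSmoothSpaceTimeOn Set.univ u → (∀ t, Literature.Analysis.FunctionSpaces.Torus.IsDivFree (u t)) →
    Literature.Analysis.FunctionSpaces.Torus.IsClassicalNSSolutionOn (Set.Icc 0 (L + Real.sqrt (ν / M))) ν (fun _ => f) u p →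
    (∀ t ∈ Set.Icc 0 (L + Real.sqrt (ν / M)), MeasureTheory.integral MeasureTheory.volume (fun x : UnitAddTorus (Fin 3) => ‖u t x‖ ^ 2) ≤ E₀) →
    ∀ (D : ℝ → ℝ → UnitAddTorus (Fin 3) → EuclideanSpace ℝ (Fin 3)) (J : ℝ → ℝ → UnitAddTorus (Fin 3) → (EuclideanSpace ℝ (Fin 3) →L[ℝ] EuclideanSpace ℝ (Fin 3))),
    ((∀ t x, D t t x = 0) ∧
    (∀ t s x, HasDerivAt (fun r => D t r x) (u s (x + Literature.Analysis.FunctionSpaces.Torus.proj (D t s x))) s) ∧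
    (∀ t x, J t t x = ContinuousLinearMap.id ℝ (EuclideanSpace ℝ (Fin 3))) ∧
    (∀ t s x, HasDerivAt (fun r => J t r x) ((Literature.Analysis.FunctionSpaces.Torus.fderiv (u s) (x + Literature.Analysis.FunctionSpaces.Torus.proj (D t s x))).comp (J t s x)) s) ∧
    (∀ t s, MeasureTheory.MeasurePreserving (fun x : UnitAddTorus (Fin 3) => x + Literature.Analysis.FunctionSpaces.Torus.proj (D t s x)) MeasureTheory.volume MeasureTheory.volume) ∧
    Continuous (fun q : ℝ × ℝ × UnitAddTorus (Fin 3) => (D q.1 q.2.1 q.2.2, J q.1 q.2.1 q.2.2))) →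
    κ * (ν * ∫ t in (0 : ℝ)..(L + Real.sqrt (ν / M)), Literature.Analysis.FunctionSpaces.Torus.gradNormSq (u t)) - β ≤
    ν * ∫ t in (0 : ℝ)..L, MeasureTheory.integral MeasureTheory.volume
    (fun x : UnitAddTorus (Fin 3) => ((Real.sqrt (ν / M))⁻¹ * Real.log ‖J t (t + Real.sqrt (ν / M)) x‖) ^ 2) := by
  sorry

/-- Composition (no sorry outside the stubs): existence of the flow + the estimate for given flows ⇒ K. -/
theorem KolmogorovHorizonCapture_of : KolmogorovHorizonCapture := by
  intro f hfs hfd hfm E₀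
  obtain ⟨M, κ, β, hM, hκ, hcap⟩ := stub_captureGivenFlow f hfs hfd hfm E₀
  refine ⟨M, κ, β, hM, hκ, ?_⟩
  intro ν hν hν1 L hL u p hu hdiv hNS hEn
  obtain ⟨D, J, hLF⟩ := stub_lagrangianFlowExists u hu hdiv
  exact ⟨D, J, hLF, hcap ν hν hν1 L hL u p hu hdiv hNS hEn D J hLF⟩

end Summit.AnomalousDissipation.AnomalousDissipation.Cruxes.KolmogorovHorizonChaos.SplitWindowCapture.CaptureBirth

end
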